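import Mathlib
import Summits.AtomisticToContinuum.HydrodynamicLimit.Theorems.ImplosionDichotomyDenseExcursionPackingAnalyticHierarchyCalculus

/-!
# The hierarchy of the analytic packing implosion `Γ` at EVERY order
# (crux `DenseExcursion`, stmt-AtomisticToContinuum-12586, line `packing-analytic-implosion`)

Helper file (`--supports stmt-AtomisticToContinuum-12586`, line lead a2, stub `stub_analyticPackingImplosion` of
`…PackingAnalyticDefs.lean`). THE FORMAL HIERARCHY AT ORDER `k`, kernel-checked, generalising the landed
`packingHierarchy_order_one` (`…PackingAnalyticOrderOne`): if `(w, s)(G, x)` is jointly `C^∞` on `(−g₀, g₀) × ℝ`,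
equals `(W, S)` at `G = 0` and solves the two equations of `AnalyticPackingImplosion r W S M` (`∂_τ = μG∂_G`,
`μ = 3(r−1)`, stiffening law `M` analytic at `0` with `M 0 = 1`), then the `G`-Taylor coefficients
`X_k = (wc k, sc k) := (∂_G^k w, ∂_G^k s)(0, ·)/k!` solve, for EVERY `k ≥ 1`,

  `kμ · wc k − linW(wc k, sc k) = Σ_{0<i<k} [wc i · (wc (k−i))′ + wc i · wc (k−i) + 3 sc i ((sc (k−i))′ + sc (k−i))]`
                                 `+ 3 Σ_{p<k} (Σ_{i≤p} sc i ((sc (p−i))′ + sc (p−i))) · Mc (k−p)`,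
  `kμ · sc k − linS(wc k, sc k) = Σ_{0<i<k} [wc i · (sc (k−i))′ + (sc i/3) (wc (k−i))′ + 2 sc i · wc (k−i)]`

(`packingHierarchy_order`, REGISTERED helper; `L = (linW, linS)` of `…R2Modes`, real pairs coerced to `ℂ` exactly as
in `LargeRealResolvent` and `hierarchy_solution_unique`), where `Mc c = ∂_G^c[M(G e^{3x} s(G, x)³)](0, x)/c!` are the
Taylor coefficients of the stiffening factor ALONG THE FAMILY (`Mc 0 = 1`, `Mc 1 = M′(0)e^{3x}S³`; they involve only
`sc 1, …, sc (c−1)` and the jet of `M`). So every order is the resolvent problem `(kμ − L)X_k = Src_k` with `Src_k` an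
explicit polynomial in the lower orders and their first `x`-derivatives (one derivative per monomial: the system is
first order) — unique by `hierarchy_solution_unique` (packing non-resonance), which is what the majorant scheme of
`stub_analyticPackingImplosion` iterates (`analytic_majorant`).

Proof: at fixed `x` the two equations are identities between smooth functions of `G` near `0`; their Taylor series
at `0` (`PowerSeries.mk (n ↦ ∂ⁿ·(0)/n!)`, calculus of `…PackingAnalyticHierarchyCalculus`: products ↦ products, `μG∂_G`
↦ `kμ` on the `k`-th coefficient) give power-series identities whose `k`-th coefficients, with the extreme terms of
each convolution peeled off (they form `L`), are the displayed identities (`hierarchy_coeff_w/s`, abstract one-variable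
forms); the `x`-derivatives of the coefficients are the coefficients of the `x`-derivatives by the exchange lemma
`hasDerivAt_taylorCoeffG` (Schwarz, iterated). NOT here: existence of `Γ`, norms, the expansion of `Mc` in the jet of
`M` (Faà di Bruno form; separate file).
-/

noncomputable section

open Filter Set Finset PowerSeries
open scoped Topology ContDiff

namespace Summit.AtomisticToContinuum.HydrodynamicLimit.Theorems.PackingAnalyticImplosion

open Summit.AtomisticToContinuum.HydrodynamicLimit.Theorems.R2OneModeTwoConditions

/-! ## The abstract coefficient identities (one variable `G`, Taylor coefficients at `0`) -/

section Abstract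

/-- `taylorSeries_mul` in lambda form. [folklore] -/
theorem taylorSeries_fun_mul {f g : ℝ → ℝ} (hf : ContDiffAt ℝ ∞ f 0) (hg : ContDiffAt ℝ ∞ g 0) :
    PowerSeries.mk (fun n => iteratedDeriv n (fun G => f G * g G) 0 / (n.factorial : ℝ)) =
      PowerSeries.mk (fun n => iteratedDeriv n f 0 / (n.factorial : ℝ)) *
        PowerSeries.mk (fun n => iteratedDeriv n g 0 / (n.factorial : ℝ)) :=
  taylorSeries_mul hf hg

/-- `taylorSeries_add` in lambda form. [folklore] -/
theorem taylorSeries_fun_add {f g : ℝ → ℝ} (hf : ContDiffAt ℝ ∞ f 0) (hg : ContDiffAt ℝ ∞ g 0) :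
    PowerSeries.mk (fun n => iteratedDeriv n (fun G => f G + g G) 0 / (n.factorial : ℝ)) =
      PowerSeries.mk (fun n => iteratedDeriv n f 0 / (n.factorial : ℝ)) +
        PowerSeries.mk (fun n => iteratedDeriv n g 0 / (n.factorial : ℝ)) :=
  taylorSeries_add hf hg

/-- `taylorSeries_sub` in lambda form. [folklore] -/
theorem taylorSeries_fun_sub {f g : ℝ → ℝ} (hf : ContDiffAt ℝ ∞ f 0) (hg : ContDiffAt ℝ ∞ g 0) :
    PowerSeries.mk (fun n => iteratedDeriv n (fun G => f G - g G) 0 / (n.factorial : ℝ)) =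
      PowerSeries.mk (fun n => iteratedDeriv n f 0 / (n.factorial : ℝ)) -
        PowerSeries.mk (fun n => iteratedDeriv n g 0 / (n.factorial : ℝ)) :=
  taylorSeries_sub hf hg

/-- Peel the two extreme terms off a `range (k+1)` sum, `k ≥ 1`. [folklore] -/
theorem sum_range_succ_peel (g : ℕ → ℝ) {k : ℕ} (hk : 1 ≤ k) :
    ∑ i ∈ Finset.range (k + 1), g i = g 0 + g k + ∑ i ∈ Finset.Ico 1 k, g i := by
  rw [Finset.range_eq_Ico, Finset.sum_Ico_succ_top (Nat.zero_le k),
    Finset.sum_eq_sum_Ico_succ_bot (by omega : 0 < k)]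
  ring

/-- Coefficient `k` of a product of two real power series given by coefficient sequences, as a `range` sum.
[folklore] -/
theorem coeff_mk_mul_mk (a b : ℕ → ℝ) (k : ℕ) :
    PowerSeries.coeff k (PowerSeries.mk a * PowerSeries.mk b) = ∑ i ∈ Finset.range (k + 1), a i * b (k - i) := by
  rw [coeff_mul, Nat.sum_antidiagonal_eq_sum_range_succ (fun i j => coeff i (PowerSeries.mk a) *
    coeff j (PowerSeries.mk b)) k]
  simp only [coeff_mk]

/-- A coefficient sequence named by a defining hypothesis gives the Taylor series. [folklore] -/
theorem taylorSeries_eq_mk {f : ℝ → ℝ} {a : ℕ → ℝ} (ha : ∀ n, a n = iteratedDeriv n f 0 / (n.factorial : ℝ)) :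
    PowerSeries.mk (fun n => iteratedDeriv n f 0 / (n.factorial : ℝ)) = PowerSeries.mk a := by
  ext n; simp [coeff_mk, ha]

/-- THE `W`-COEFFICIENT IDENTITY (abstract form). If smooth `A, Ax, B, Bx, Φ` satisfy near `G = 0`
`μ G A′ = (A − 1)Ax + A² − rA + 3B(Bx + B)Φ`, then their Taylor coefficients `a, a′, b, b′, φ` at `0` satisfy, for
`k ≥ 1`, `kμ a_k − [linear part] = [quadratic part] + 3 Σ_{p<k} (Σ_{i≤p} b_i (b′_{p−i} + b_{p−i})) φ_{k−p}`.
[folklore] -/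
theorem hierarchy_coeff_w {A Ax B Bx Φ : ℝ → ℝ} {μ r : ℝ} (hA : ContDiffAt ℝ ∞ A 0) (hAx : ContDiffAt ℝ ∞ Ax 0)
    (hB : ContDiffAt ℝ ∞ B 0) (hBx : ContDiffAt ℝ ∞ Bx 0) (hΦ : ContDiffAt ℝ ∞ Φ 0)
    (heq : (fun G => μ * G * deriv A G) =ᶠ[𝓝 0]
      fun G => (A G - 1) * Ax G + A G ^ 2 - r * A G + 3 * B G * (Bx G + B G) * Φ G)
    {a a' b b' φ : ℕ → ℝ} (ha : ∀ n, a n = iteratedDeriv n A 0 / (n.factorial : ℝ))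
    (ha' : ∀ n, a' n = iteratedDeriv n Ax 0 / (n.factorial : ℝ))
    (hb : ∀ n, b n = iteratedDeriv n B 0 / (n.factorial : ℝ))
    (hb' : ∀ n, b' n = iteratedDeriv n Bx 0 / (n.factorial : ℝ))
    (hφ : ∀ n, φ n = iteratedDeriv n Φ 0 / (n.factorial : ℝ)) {k : ℕ} (hk : 1 ≤ k) :
    μ * k * a k - ((a 0 - 1) * a' k + a k * a' 0 + 2 * a 0 * a k - r * a k +
        3 * (b 0 * (b' k + b k) + b k * (b' 0 + b 0)) * φ 0) =
      (∑ i ∈ Finset.Ico 1 k, (a i * a' (k - i) + a i * a (k - i) + 3 * (b i * (b' (k - i) + b (k - i))) * φ 0)) +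
        3 * ∑ p ∈ Finset.range k, (∑ i ∈ Finset.range (p + 1), b i * (b' (p - i) + b (p - i))) * φ (k - p) := by
  -- re-associate the functional equation
  have heq' : (fun G => μ * G * deriv A G) =ᶠ[𝓝 0]
      fun G => ((A G - 1) * Ax G + (A G * A G - r * A G)) + 3 * (B G * ((Bx G + B G) * Φ G)) :=
    heq.trans (Eventually.of_forall fun G => by ring)
  -- Taylor series of both sides
  have hT := taylorSeries_congr heq'
  -- push the Taylor-series map through the right-hand side
  have s1 := taylorSeries_fun_add (f := fun G => (A G - 1) * Ax G + (A G * A G - r * A G))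
    (g := fun G => 3 * (B G * ((Bx G + B G) * Φ G))) (by fun_prop) (by fun_prop)
  have s2 := taylorSeries_fun_add (f := fun G => (A G - 1) * Ax G) (g := fun G => A G * A G - r * A G)
    (by fun_prop) (by fun_prop)
  have s3 := taylorSeries_fun_mul (f := fun G => A G - 1) (g := Ax) (by fun_prop) hAx
  have s4 := taylorSeries_fun_sub (f := A) (g := fun _ => (1 : ℝ)) hA (by fun_prop)
  have s5 := taylorSeries_const (1 : ℝ)
  have s6 := taylorSeries_fun_sub (f := fun G => A G * A G) (g := fun G => r * A G) (by fun_prop) (by fun_prop)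
  have s7 := taylorSeries_fun_mul (f := A) (g := A) hA hA
  have s8 := taylorSeries_const_mul (f := A) hA r
  have s9 := taylorSeries_const_mul (f := fun G => B G * ((Bx G + B G) * Φ G)) (by fun_prop) 3
  have s10 := taylorSeries_fun_mul (f := B) (g := fun G => (Bx G + B G) * Φ G) hB (by fun_prop)
  have s11 := taylorSeries_fun_mul (f := fun G => Bx G + B G) (g := Φ) (by fun_prop) hΦ
  have s12 := taylorSeries_fun_add (f := Bx) (g := B) hBx hB
  have eA := taylorSeries_eq_mk ha
  have eAx := taylorSeries_eq_mk ha'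
  have eB := taylorSeries_eq_mk hb
  have eBx := taylorSeries_eq_mk hb'
  have eΦ := taylorSeries_eq_mk hφ
  have hRHS : PowerSeries.mk (fun n => iteratedDeriv n
      (fun G => ((A G - 1) * Ax G + (A G * A G - r * A G)) + 3 * (B G * ((Bx G + B G) * Φ G))) 0 /
        (n.factorial : ℝ)) =
      (PowerSeries.mk a - PowerSeries.C (1 : ℝ)) * PowerSeries.mk a' +
        (PowerSeries.mk a * PowerSeries.mk a - PowerSeries.C r * PowerSeries.mk a) +
        PowerSeries.C (3 : ℝ) * (PowerSeries.mk b * ((PowerSeries.mk b' + PowerSeries.mk b) * PowerSeries.mk φ)) := by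
    rw [← eA, ← eAx, ← eB, ← eBx, ← eΦ, ← s5, ← s4, ← s3, ← s7, ← s8, ← s6, ← s2, ← s12, ← s11, ← s10, ← s9, ← s1]
  -- coefficient `k` of both sides
  have ebb : PowerSeries.mk b' + PowerSeries.mk b = PowerSeries.mk (fun n => b' n + b n) := by
    ext n; simp
  have hre : (PowerSeries.mk a - PowerSeries.C (1 : ℝ)) * PowerSeries.mk a' +
        (PowerSeries.mk a * PowerSeries.mk a - PowerSeries.C r * PowerSeries.mk a) +
        PowerSeries.C (3 : ℝ) * (PowerSeries.mk b * ((PowerSeries.mk b' + PowerSeries.mk b) * PowerSeries.mk φ)) =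
      PowerSeries.mk a * PowerSeries.mk a' - PowerSeries.mk a' + PowerSeries.mk a * PowerSeries.mk a -
        PowerSeries.C r * PowerSeries.mk a +
        PowerSeries.C (3 : ℝ) * ((PowerSeries.mk b * PowerSeries.mk (fun n => b' n + b n)) * PowerSeries.mk φ) := by
    rw [ebb, map_one]; ring
  have hcoeff := congrArg (PowerSeries.coeff k) ((hT.trans hRHS).trans hre)
  rw [coeff_mk, coeff_taylorSeries_transport hA μ k, ← ha k] at hcoeff
  simp only [map_add, map_sub, coeff_C_mul, coeff_mk, coeff_mk_mul_mk] at hcoeff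
  rw [coeff_mul, Nat.sum_antidiagonal_eq_sum_range_succ (fun i j =>
    coeff i (PowerSeries.mk b * PowerSeries.mk (fun n => b' n + b n)) * coeff j (PowerSeries.mk φ)) k] at hcoeff
  simp only [coeff_mk, coeff_mk_mul_mk] at hcoeff
  -- peel the extreme terms
  rw [sum_range_succ_peel (fun i => a i * a' (k - i)) hk, sum_range_succ_peel (fun i => a i * a (k - i)) hk,
    Finset.sum_range_succ, sum_range_succ_peel (fun i => b i * (b' (k - i) + b (k - i))) hk] at hcoeff
  simp only [Nat.sub_zero, Nat.sub_self] at hcoeff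
  -- split the target sum
  have split : ∑ i ∈ Finset.Ico 1 k, (a i * a' (k - i) + a i * a (k - i) + 3 * (b i * (b' (k - i) + b (k - i))) * φ 0) =
      (∑ i ∈ Finset.Ico 1 k, a i * a' (k - i)) + (∑ i ∈ Finset.Ico 1 k, a i * a (k - i)) +
        3 * φ 0 * ∑ i ∈ Finset.Ico 1 k, b i * (b' (k - i) + b (k - i)) := by
    rw [Finset.mul_sum, ← Finset.sum_add_distrib, ← Finset.sum_add_distrib]
    exact Finset.sum_congr rfl fun i _ => by ring
  rw [split]
  linear_combination hcoeff

/-- THE `S`-COEFFICIENT IDENTITY (abstract form). If smooth `A, Ax, B, Bx` satisfy near `G = 0`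
`μ G B′ = (A − 1)Bx + (B/3)Ax + B(2A − r)`, then their Taylor coefficients at `0` satisfy, for `k ≥ 1`,
`kμ b_k − [linear part] = Σ_{0<i<k} (a_i b′_{k−i} + b_i a′_{k−i}/3 + 2 b_i a_{k−i})`. [folklore] -/
theorem hierarchy_coeff_s {A Ax B Bx : ℝ → ℝ} {μ r : ℝ} (hA : ContDiffAt ℝ ∞ A 0) (hAx : ContDiffAt ℝ ∞ Ax 0)
    (hB : ContDiffAt ℝ ∞ B 0) (hBx : ContDiffAt ℝ ∞ Bx 0)
    (heq : (fun G => μ * G * deriv B G) =ᶠ[𝓝 0]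
      fun G => (A G - 1) * Bx G + B G / 3 * Ax G + B G * (2 * A G - r))
    {a a' b b' : ℕ → ℝ} (ha : ∀ n, a n = iteratedDeriv n A 0 / (n.factorial : ℝ))
    (ha' : ∀ n, a' n = iteratedDeriv n Ax 0 / (n.factorial : ℝ))
    (hb : ∀ n, b n = iteratedDeriv n B 0 / (n.factorial : ℝ))
    (hb' : ∀ n, b' n = iteratedDeriv n Bx 0 / (n.factorial : ℝ)) {k : ℕ} (hk : 1 ≤ k) :
    μ * k * b k - ((a 0 - 1) * b' k + a k * b' 0 + 1 / 3 * (b 0 * a' k + b k * a' 0) +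
        2 * (b 0 * a k + b k * a 0) - r * b k) =
      ∑ i ∈ Finset.Ico 1 k, (a i * b' (k - i) + b i / 3 * a' (k - i) + 2 * (b i * a (k - i))) := by
  -- re-associate the functional equation
  have heq' : (fun G => μ * G * deriv B G) =ᶠ[𝓝 0]
      fun G => ((A G - 1) * Bx G + 1 / 3 * (B G * Ax G)) + B G * (2 * A G - r) :=
    heq.trans (Eventually.of_forall fun G => by ring)
  have hT := taylorSeries_congr heq'
  have s1 := taylorSeries_fun_add (f := fun G => (A G - 1) * Bx G + 1 / 3 * (B G * Ax G))
    (g := fun G => B G * (2 * A G - r)) (by fun_prop) (by fun_prop)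
  have s2 := taylorSeries_fun_add (f := fun G => (A G - 1) * Bx G) (g := fun G => 1 / 3 * (B G * Ax G))
    (by fun_prop) (by fun_prop)
  have s3 := taylorSeries_fun_mul (f := fun G => A G - 1) (g := Bx) (by fun_prop) hBx
  have s4 := taylorSeries_fun_sub (f := A) (g := fun _ => (1 : ℝ)) hA (by fun_prop)
  have s5 := taylorSeries_const (1 : ℝ)
  have s6 := taylorSeries_const_mul (f := fun G => B G * Ax G) (by fun_prop) (1 / 3)
  have s7 := taylorSeries_fun_mul (f := B) (g := Ax) hB hAx
  have s8 := taylorSeries_fun_mul (f := B) (g := fun G => 2 * A G - r) hB (by fun_prop)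
  have s9 := taylorSeries_fun_sub (f := fun G => 2 * A G) (g := fun _ => r) (by fun_prop) (by fun_prop)
  have s10 := taylorSeries_const r
  have s11 := taylorSeries_const_mul (f := A) hA 2
  have eA := taylorSeries_eq_mk ha
  have eAx := taylorSeries_eq_mk ha'
  have eB := taylorSeries_eq_mk hb
  have eBx := taylorSeries_eq_mk hb'
  have hRHS : PowerSeries.mk (fun n => iteratedDeriv n
      (fun G => ((A G - 1) * Bx G + 1 / 3 * (B G * Ax G)) + B G * (2 * A G - r)) 0 / (n.factorial : ℝ)) =
      (PowerSeries.mk a - PowerSeries.C (1 : ℝ)) * PowerSeries.mk b' +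
        PowerSeries.C (1 / 3 : ℝ) * (PowerSeries.mk b * PowerSeries.mk a') +
        PowerSeries.mk b * (PowerSeries.C (2 : ℝ) * PowerSeries.mk a - PowerSeries.C r) := by
    rw [← eA, ← eAx, ← eB, ← eBx, ← s5, ← s4, ← s3, ← s7, ← s6, ← s2, ← s10, ← s11, ← s9, ← s8, ← s1]
  have hre : (PowerSeries.mk a - PowerSeries.C (1 : ℝ)) * PowerSeries.mk b' +
        PowerSeries.C (1 / 3 : ℝ) * (PowerSeries.mk b * PowerSeries.mk a') +
        PowerSeries.mk b * (PowerSeries.C (2 : ℝ) * PowerSeries.mk a - PowerSeries.C r) =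
      PowerSeries.mk a * PowerSeries.mk b' - PowerSeries.mk b' +
        PowerSeries.C (1 / 3 : ℝ) * (PowerSeries.mk b * PowerSeries.mk a') +
        PowerSeries.C (2 : ℝ) * (PowerSeries.mk b * PowerSeries.mk a) - PowerSeries.C r * PowerSeries.mk b := by
    rw [map_one]; ring
  have hcoeff := congrArg (PowerSeries.coeff k) ((hT.trans hRHS).trans hre)
  rw [coeff_mk, coeff_taylorSeries_transport hB μ k, ← hb k] at hcoeff
  simp only [map_add, map_sub, coeff_C_mul, coeff_mk, coeff_mk_mul_mk] at hcoeff
  rw [sum_range_succ_peel (fun i => a i * b' (k - i)) hk, sum_range_succ_peel (fun i => b i * a' (k - i)) hk,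
    sum_range_succ_peel (fun i => b i * a (k - i)) hk] at hcoeff
  simp only [Nat.sub_zero, Nat.sub_self] at hcoeff
  have split : ∑ i ∈ Finset.Ico 1 k, (a i * b' (k - i) + b i / 3 * a' (k - i) + 2 * (b i * a (k - i))) =
      (∑ i ∈ Finset.Ico 1 k, a i * b' (k - i)) + 1 / 3 * (∑ i ∈ Finset.Ico 1 k, b i * a' (k - i)) +
        2 * ∑ i ∈ Finset.Ico 1 k, b i * a (k - i) := by
    rw [Finset.mul_sum, Finset.mul_sum, ← Finset.sum_add_distrib, ← Finset.sum_add_distrib]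
    exact Finset.sum_congr rfl fun i _ => by ring
  rw [split]
  linear_combination hcoeff

end Abstract

/-! ## The hierarchy at every order -/

/-- **THE HIERARCHY OF `Γ` AT EVERY ORDER** (registered helper `packingHierarchy_order` of
`stub_analyticPackingImplosion`). For a jointly smooth family `(w, s)(G, x)` on `(−g₀, g₀) × ℝ` through `(W, S)` at
`G = 0` solving the two equations of `AnalyticPackingImplosion r W S M` (`M` analytic at `0`, `M 0 = 1`), the
`G`-Taylor coefficients `wc k = ∂_G^k w(0, ·)/k!`, `sc k = ∂_G^k s(0, ·)/k!` solve, for every `k ≥ 1`,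
`(kμ − L)(wc k, sc k) = Src_k`, `μ = 3(r − 1)`, `L = (linW, linS)` (real pairs coerced to `ℂ` as in
`LargeRealResolvent`/`hierarchy_solution_unique`), with the EXPLICIT sources: the quadratic transport/pressure terms
among the lower orders `0 < i < k` and the stiffening terms `3 Σ_{p<k} (Σ_{i≤p} sc i (sc′_{p−i} + sc_{p−i})) Mc_{k−p}`,
`Mc c = ∂_G^c[M(G e^{3x} s³)](0, ·)/c!` the Taylor coefficients of the stiffening factor along the family
(`Mc 0 = 1`, `Mc 1 = M′(0) e^{3x} S³`: order one is `packingHierarchy_order_one`). [folklore] -/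
theorem packingHierarchy_order :
    ∀ (r : ℝ) (W S M : ℝ → ℝ) (g₀ : ℝ) (w s : ℝ → ℝ → ℝ), 0 < g₀ →
      ContDiffOn ℝ ∞ (fun p : ℝ × ℝ => w p.1 p.2) (Set.Ioo (-g₀) g₀ ×ˢ Set.univ) →
      ContDiffOn ℝ ∞ (fun p : ℝ × ℝ => s p.1 p.2) (Set.Ioo (-g₀) g₀ ×ˢ Set.univ) →
      (∀ x, w 0 x = W x ∧ s 0 x = S x) → AnalyticAt ℝ M 0 → M 0 = 1 →
      (∀ G ∈ Set.Ioo (-g₀) g₀, ∀ x,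
        3 * (r - 1) * G * deriv (fun G' => s G' x) G =
            (w G x - 1) * deriv (fun x' => s G x') x + s G x / 3 * deriv (fun x' => w G x') x +
              s G x * (2 * w G x - r) ∧
        3 * (r - 1) * G * deriv (fun G' => w G' x) G =
            (w G x - 1) * deriv (fun x' => w G x') x + w G x ^ 2 - r * w G x +
              3 * s G x * (deriv (fun x' => s G x') x + s G x) * M (G * Real.exp (3 * x) * s G x ^ 3)) →
      ∀ (wc sc Mc : ℕ → ℝ → ℝ),
        (∀ i y, wc i y = iteratedDeriv i (fun G => w G y) 0 / (i.factorial : ℝ)) →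
        (∀ i y, sc i y = iteratedDeriv i (fun G => s G y) 0 / (i.factorial : ℝ)) →
        (∀ i y, Mc i y = iteratedDeriv i (fun G => M (G * Real.exp (3 * y) * s G y ^ 3)) 0 / (i.factorial : ℝ)) →
        ∀ k : ℕ, 1 ≤ k → ∀ x,
          (((k : ℝ) * (3 * (r - 1)) : ℝ) : ℂ) * (wc k x : ℂ) -
              linW r W S (fun y => (wc k y : ℂ)) (fun y => (sc k y : ℂ)) x =
            ((∑ i ∈ Finset.Ico 1 k, (wc i x * deriv (wc (k - i)) x + wc i x * wc (k - i) x +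
                  3 * (sc i x * (deriv (sc (k - i)) x + sc (k - i) x))) +
                3 * ∑ p ∈ Finset.range k, (∑ i ∈ Finset.range (p + 1),
                  sc i x * (deriv (sc (p - i)) x + sc (p - i) x)) * Mc (k - p) x : ℝ) : ℂ) ∧
          (((k : ℝ) * (3 * (r - 1)) : ℝ) : ℂ) * (sc k x : ℂ) -
              linS r W S (fun y => (wc k y : ℂ)) (fun y => (sc k y : ℂ)) x =
            ((∑ i ∈ Finset.Ico 1 k, (wc i x * deriv (sc (k - i)) x + sc i x / 3 * deriv (wc (k - i)) x +
                2 * (sc i x * wc (k - i) x)) : ℝ) : ℂ) := by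
  intro r W S M g₀ w s hg₀ hw hs h0 hM hM0 heq wc sc Mc hwc hsc hMc k hk x
  have h0I : (0 : ℝ) ∈ Set.Ioo (-g₀) g₀ := ⟨by linarith, hg₀⟩
  have hIn : Set.Ioo (-g₀) g₀ ∈ 𝓝 (0 : ℝ) := isOpen_Ioo.mem_nhds h0I
  have hw' : ContDiffOn ℝ ∞ (Function.uncurry w) (Set.Ioo (-g₀) g₀ ×ˢ Set.univ) := hw
  have hs' : ContDiffOn ℝ ∞ (Function.uncurry s) (Set.Ioo (-g₀) g₀ ×ˢ Set.univ) := hs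
  -- smoothness in `G` at `0` of the five ingredients
  have hA : ContDiffAt ℝ ∞ (fun G => w G x) 0 := contDiffAt_sliceG hw' h0I x
  have hB : ContDiffAt ℝ ∞ (fun G => s G x) 0 := contDiffAt_sliceG hs' h0I x
  have hAx : ContDiffAt ℝ ∞ (fun G => deriv (fun x' => w G x') x) 0 := contDiffAt_sliceG_derivX hw' h0I x
  have hBx : ContDiffAt ℝ ∞ (fun G => deriv (fun x' => s G x') x) 0 := contDiffAt_sliceG_derivX hs' h0I x
  have hinner : ContDiffAt ℝ ∞ (fun G => G * Real.exp (3 * x) * s G x ^ 3) 0 :=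
    (contDiffAt_id.mul contDiffAt_const).mul (hB.pow 3)
  have hM' : ContDiffAt ℝ ∞ M ((fun G => G * Real.exp (3 * x) * s G x ^ 3) 0) := by
    simp only [zero_mul]
    exact hM.contDiffAt
  have hΦ : ContDiffAt ℝ ∞ (fun G => M (G * Real.exp (3 * x) * s G x ^ 3)) 0 := hM'.comp 0 hinner
  -- the two equations as germs at `G = 0`
  have heqW : (fun G => 3 * (r - 1) * G * deriv (fun G' => w G' x) G) =ᶠ[𝓝 0] fun G =>
      ((fun G => w G x) G - 1) * (fun G => deriv (fun x' => w G x') x) G + (fun G => w G x) G ^ 2 -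
        r * (fun G => w G x) G + 3 * (fun G => s G x) G * ((fun G => deriv (fun x' => s G x') x) G +
        (fun G => s G x) G) * (fun G => M (G * Real.exp (3 * x) * s G x ^ 3)) G := by
    filter_upwards [hIn] with G hG using (heq G hG x).2
  have heqS : (fun G => 3 * (r - 1) * G * deriv (fun G' => s G' x) G) =ᶠ[𝓝 0] fun G =>
      ((fun G => w G x) G - 1) * (fun G => deriv (fun x' => s G x') x) G +
        (fun G => s G x) G / 3 * (fun G => deriv (fun x' => w G x') x) G +
        (fun G => s G x) G * (2 * (fun G => w G x) G - r) := by
    filter_upwards [hIn] with G hG using (heq G hG x).1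
  -- the coefficient sequences at `x`
  have ha : ∀ n, wc n x = iteratedDeriv n (fun G => w G x) 0 / (n.factorial : ℝ) := fun n => hwc n x
  have hb : ∀ n, sc n x = iteratedDeriv n (fun G => s G x) 0 / (n.factorial : ℝ) := fun n => hsc n x
  have hwcfun : ∀ n, wc n = fun y => iteratedDeriv n (fun G => w G y) 0 / (n.factorial : ℝ) :=
    fun n => funext (hwc n)
  have hscfun : ∀ n, sc n = fun y => iteratedDeriv n (fun G => s G y) 0 / (n.factorial : ℝ) :=
    fun n => funext (hsc n)
  have dwc : ∀ n, HasDerivAt (wc n) (iteratedDeriv n (fun G => deriv (fun y => w G y) x) 0 / (n.factorial : ℝ)) x := by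
    intro n; rw [hwcfun n]; exact hasDerivAt_taylorCoeffG w g₀ hg₀ hw n x
  have dsc : ∀ n, HasDerivAt (sc n) (iteratedDeriv n (fun G => deriv (fun y => s G y) x) 0 / (n.factorial : ℝ)) x := by
    intro n; rw [hscfun n]; exact hasDerivAt_taylorCoeffG s g₀ hg₀ hs n x
  have ha' : ∀ n, deriv (wc n) x = iteratedDeriv n (fun G => deriv (fun x' => w G x') x) 0 / (n.factorial : ℝ) :=
    fun n => (dwc n).deriv
  have hb' : ∀ n, deriv (sc n) x = iteratedDeriv n (fun G => deriv (fun x' => s G x') x) 0 / (n.factorial : ℝ) :=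
    fun n => (dsc n).deriv
  have hφ : ∀ n, Mc n x = iteratedDeriv n (fun G => M (G * Real.exp (3 * x) * s G x ^ 3)) 0 / (n.factorial : ℝ) :=
    fun n => hMc n x
  -- the abstract identities
  have idW := hierarchy_coeff_w hA hAx hB hBx hΦ heqW (a := fun n => wc n x) (a' := fun n => deriv (wc n) x)
    (b := fun n => sc n x) (b' := fun n => deriv (sc n) x) (φ := fun n => Mc n x) ha ha' hb hb' hφ hk
  have idS := hierarchy_coeff_s hA hAx hB hBx heqS (a := fun n => wc n x) (a' := fun n => deriv (wc n) x)
    (b := fun n => sc n x) (b' := fun n => deriv (sc n) x) ha ha' hb hb' hk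
  -- order-zero values
  have hW0 : ∀ y, w 0 y = W y := fun y => (h0 y).1
  have hS0 : ∀ y, s 0 y = S y := fun y => (h0 y).2
  have ewc0 : wc 0 = W := by
    funext y; rw [hwc 0 y]; simp [hW0 y]
  have esc0 : sc 0 = S := by
    funext y; rw [hsc 0 y]; simp [hS0 y]
  have eMc0 : Mc 0 x = 1 := by
    rw [hMc 0 x]; simp [hM0]
  simp only [ewc0, esc0, eMc0, mul_one] at idW idS
  -- complex derivatives of the coerced coefficients
  have hdw := (dwc k).ofReal_comp.deriv
  have hds := (dsc k).ofReal_comp.deriv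
  rw [← ha' k] at hdw
  rw [← hb' k] at hds
  have idWC := congrArg (fun t : ℝ => (t : ℂ)) idW
  have idSC := congrArg (fun t : ℝ => (t : ℂ)) idS
  refine ⟨?_, ?_⟩
  · simp only [linW, hdw, hds]
    push_cast at idWC ⊢
    linear_combination idWC
  · simp only [linS, hdw, hds]
    push_cast at idSC ⊢
    linear_combination idSC



end Summit.AtomisticToContinuum.HydrodynamicLimit.Theorems.PackingAnalyticImplosion

end
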